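import Summits.AtomisticToContinuum.Crystallization.Theorems.TwoCentreKissingKernelRobustTangencyBoundGeomBlocks
import Literature.Geometry.DiscreteGeometry.SphericalCodeHullEulerFormula
import HarnessLib

/-!
# `RobustTangencyBound` — corners of general (polygonal) soft facets (step (III), blueprint §13b)

Route `TwoCentreKissingKernel`, item `stmt-AtomisticToContinuum-12082`.  The cluster lemmas so far
take triangular facets (`corner_block`).  A soft planar quadrilateral or pentagonal FACET (the square of
the cuboctahedron is one) has a larger tight set; its corner at a vertex `y` is the angle between the
tangent directions towards the two HULL-EDGE neighbours `u, w` of `y` on the facet, so it is again ONE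
forward-form corner block whose "opposite side" is the facet diagonal `⟪u, w⟫`.  Three facts:
* `pair_mem_hullEdges_of_soft` — a soft pair (`⟪y,u⟫ ≥ 1/2 − 3η`) spans a hull edge (`η ≤ 10⁻³`);
* `cornerAngle_of_hullEdges` — if `{y,u}` and `{y,w}` are hull edges inside the facet `c` (`u ≠ w`) then
  `cornerAngle X c y = ∠(t_y u, t_y w)` (via `consecutive_of_mem_hullEdges` and the polygonal-cone vertex
  wedge);
* `corner_block_polygon` — the forward cosine / sine of that corner, exactly as `corner_block`.
With these, every factory certificate for triangulated clusters applies verbatim to planar facets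
(pseudo-facets `(y; u, w)` per corner).
-/

noncomputable section

namespace Summit.AtomisticToContinuum.Crystallization.Theorems

open Real RealInnerProductSpace InnerProductGeometry Literature.Geometry.DiscreteGeometry
  Literature.Analysis.ValidatedNumerics Finset

/-- **A soft pair spans a hull edge.** If all pairwise inner products on `X ⊆ S²` are `≤ 1/2 + 2η`
and `⟪y, u⟫ ≥ 1/2 − 3η` (`η ≤ 10⁻³`), then `{y, u}` is the tight set of the edge normal
`(1 + ⟪y,u⟫)⁻¹ • (y + u)`. -/
theorem pair_mem_hullEdges_of_soft {X : Finset (EuclideanSpace ℝ (Fin 3))} (hX1 : ∀ z ∈ X, ‖z‖ = 1)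
    {η : ℝ} (hη : η ≤ 1 / 1000)
    (hsep : ∀ p ∈ X, ∀ q ∈ X, p ≠ q → ⟪p, q⟫ ≤ 1 / 2 + 2 * η)
    {y u : EuclideanSpace ℝ (Fin 3)} (hy : y ∈ X) (hu : u ∈ X) (hyu : y ≠ u)
    (s : 1 / 2 - 3 * η ≤ ⟪y, u⟫) : ({y, u} : Finset _) ∈ hullEdges X := by
  classical
  have hy1 : ⟪y, y⟫ = 1 := by rw [real_inner_self_eq_norm_sq, hX1 y hy]; norm_num
  have hu1 : ⟪u, u⟫ = 1 := by rw [real_inner_self_eq_norm_sq, hX1 u hu]; norm_num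
  have hpos : 0 < 1 + ⟪y, u⟫ := by linarith
  set c₀ : EuclideanSpace ℝ (Fin 3) := (1 + ⟪y, u⟫)⁻¹ • (y + u) with hc₀
  have hval : ∀ x, ⟪c₀, x⟫ = (1 + ⟪y, u⟫)⁻¹ * (⟪y, x⟫ + ⟪u, x⟫) := by
    intro x; rw [hc₀, real_inner_smul_left, inner_add_left]
  have hcy : ⟪c₀, y⟫ = 1 := by
    rw [hval, hy1, real_inner_comm y u]; exact inv_mul_cancel₀ hpos.ne'
  have hcu : ⟪c₀, u⟫ = 1 := by
    rw [hval, hu1, add_comm ⟪y, u⟫ 1]; exact inv_mul_cancel₀ hpos.ne'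
  have hlt : ∀ x ∈ X, x ≠ y → x ≠ u → ⟪c₀, x⟫ < 1 := by
    intro x hx hxy hxu
    rw [hval]
    have h1 := hsep y hy x hx (Ne.symm hxy)
    have h2 := hsep u hu x hx (Ne.symm hxu)
    rw [inv_mul_lt_iff₀ hpos]; linarith
  have hle : ∀ x ∈ X, ⟪c₀, x⟫ ≤ 1 := by
    intro x hx
    by_cases hxy : x = y
    · rw [hxy, hcy]
    by_cases hxu : x = u
    · rw [hxu, hcu]
    exact (hlt x hx hxy hxu).le
  have hT : tightSet X c₀ = {y, u} := by
    ext x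
    rw [mem_tightSet, mem_insert, mem_singleton]
    constructor
    · rintro ⟨hx, hx1⟩
      by_contra h
      simp only [not_or] at h
      exact (hlt x hx h.1 h.2).ne hx1
    · rintro (rfl | rfl)
      · exact ⟨hy, hcy⟩
      · exact ⟨hu, hcu⟩
  rw [mem_hullEdges]
  refine ⟨c₀, ⟨hle, ?_⟩, hT⟩
  rw [hT, card_pair hyu]

/-- **The corner of a polygonal facet at `y` is the angle towards its two hull-edge neighbours.**
If `{y, u}` and `{y, w}` are hull edges contained in the facet `c` and `u ≠ w`, then
`cornerAngle X c y = ∠(t_y u, t_y w)`. -/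
theorem cornerAngle_of_hullEdges {X : Finset (EuclideanSpace ℝ (Fin 3))} (hX1 : ∀ z ∈ X, ‖z‖ = 1)
    (h0 : (0 : EuclideanSpace ℝ (Fin 3)) ∈ interior (convexHull ℝ (X : Set (EuclideanSpace ℝ (Fin 3)))))
    {c y u w : EuclideanSpace ℝ (Fin 3)} (hcF : c ∈ facetNormals X)
    (hy : y ∈ tightSet X c) (hu : u ∈ tightSet X c) (hw : w ∈ tightSet X c)
    (hyu : y ≠ u) (hyw : y ≠ w) (huw : u ≠ w)
    (heu : ({y, u} : Finset _) ∈ hullEdges X) (hew : ({y, w} : Finset _) ∈ hullEdges X) :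
    cornerAngle X c y = angle (perpTo y u) (perpTo y w) := by
  classical
  set hc := ne_zero_of_mem_facetNormals hX1 hcF
  set m := (facetAngles X c hc).card with hm
  set v := facetVertex X c hc with hvdef
  have hm3 : 3 ≤ m := by rw [hm, card_facetAngles hX1 hc]; exact three_le_card_tightSet hcF
  have hwor : ∀ i j k, i < j → j < k → k < m → 0 < orient3 (v i) (v j) (v k) :=
    fun i j k hij hjk hk => orient3_facetVertex_pos hX1 hcF hij hjk hk
  have hinj : ∀ i i', i < m → i' < m → v i = v i' → i = i' :=
    fun i i' hi hi' h => facetVertex_injOn hc (by rw [Finset.coe_range, Set.mem_Iio]; exact hi)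
      (by rw [Finset.coe_range, Set.mem_Iio]; exact hi') h
  -- the two edges are consecutive pairs
  obtain ⟨j, hj, hju⟩ := consecutive_of_mem_hullEdges hX1 h0 hcF heu
    (by intro x hx; rw [mem_insert, mem_singleton] at hx; rcases hx with rfl | rfl <;> assumption)
  obtain ⟨k, hk, hkw⟩ := consecutive_of_mem_hullEdges hX1 h0 hcF hew
    (by intro x hx; rw [mem_insert, mem_singleton] at hx; rcases hx with rfl | rfl <;> assumption)
  -- unfold the corner angle via the polygonal cone
  have hcorner : ∀ i, i < m → v i = y →
      cornerAngle X c y = angle (perpTo y (v ((i + m - 1) % m))) (perpTo y (v ((i + 1) % m))) := by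
    intro i hi hiy
    rw [cornerAngle, argmaxCone_eq_polyCone hX1 h0 hcF, ← hiy]
    rw [ballFraction_dirCone_polyCone_vertex hm3 hwor hi, polyDih, mul_div_cancel₀ _ (by positivity)]
  -- from `{y,u} = {v j, v (j+1)}`: either y = v j, u = v (j+1) or y = v (j+1), u = v j
  have hj1 : (j + 1) % m < m := Nat.mod_lt _ (by omega)
  have hk1 : (k + 1) % m < m := Nat.mod_lt _ (by omega)
  have pair_cases : ∀ {a b p q : EuclideanSpace ℝ (Fin 3)}, a ≠ b → ({a, b} : Finset _) = {p, q} →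
      (a = p ∧ b = q) ∨ (a = q ∧ b = p) := by
    intro a b p q hab h
    have ha : a ∈ ({p, q} : Finset _) := by rw [← h]; simp
    have hb : b ∈ ({p, q} : Finset _) := by rw [← h]; simp
    rw [mem_insert, mem_singleton] at ha hb
    rcases ha with rfl | rfl <;> rcases hb with rfl | rfl
    · exact absurd rfl hab
    · exact Or.inl ⟨rfl, rfl⟩
    · exact Or.inr ⟨rfl, rfl⟩
    · exact absurd rfl hab
  -- index arithmetic helpers
  have pred_succ : ∀ i, i < m → ((i + 1) % m + m - 1) % m = i := by
    intro i hi
    rcases Nat.lt_or_ge (i + 1) m with h | h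
    · rw [Nat.mod_eq_of_lt h, show i + 1 + m - 1 = i + m by omega, Nat.add_mod_right, Nat.mod_eq_of_lt hi]
    · have : i = m - 1 := by omega
      subst this
      rw [show m - 1 + 1 = m by omega, Nat.mod_self, Nat.zero_add, Nat.mod_eq_of_lt (by omega)]
  have succ_pred : ∀ i, i < m → ((i + m - 1) % m + 1) % m = i := by
    intro i hi
    rcases Nat.eq_zero_or_pos i with rfl | hip
    · rw [Nat.zero_add, Nat.mod_eq_of_lt (by omega : m - 1 < m), show m - 1 + 1 = m by omega, Nat.mod_self]
    · rw [show i + m - 1 = (i - 1) + m by omega, Nat.add_mod_right, Nat.mod_eq_of_lt (by omega : i - 1 < m),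
        show i - 1 + 1 = i by omega, Nat.mod_eq_of_lt hi]
  rcases pair_cases hyu hju with ⟨hyj, huj⟩ | ⟨hyj, huj⟩
  · -- y = v j, u = v (j+1): then w must be v (j-1)
    rw [hcorner j hj hyj.symm]
    rcases pair_cases hyw hkw with ⟨hyk, hwk⟩ | ⟨hyk, hwk⟩
    · -- y = v k ⇒ k = j ⇒ w = v (j+1) = u, contradiction
      have : k = j := hinj k j hk hj (hyk.symm.trans hyj)
      subst this
      exact absurd (huj.trans hwk.symm) huw
    · -- y = v (k+1), w = v k ⇒ (k+1)%m = j ⇒ k = (j+m-1)%m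
      have hkj : (k + 1) % m = j := hinj _ _ hk1 hj (hyk.symm.trans hyj)
      have : (j + m - 1) % m = k := by rw [← hkj]; exact pred_succ k hk
      rw [this, huj, hwk]
      exact angle_comm _ _
  · -- y = v (j+1), u = v j: then w must be v (j+2)
    rw [hcorner _ hj1 hyj.symm, pred_succ j hj, huj]
    rcases pair_cases hyw hkw with ⟨hyk, hwk⟩ | ⟨hyk, hwk⟩
    · -- y = v k, w = v (k+1) ⇒ k = (j+1)%m
      have hkj : k = (j + 1) % m := hinj _ _ hk hj1 (hyk.symm.trans hyj)
      subst hkj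
      rw [hwk]
    · -- y = v (k+1) ⇒ (k+1)%m = (j+1)%m ⇒ w = v k = v j = u: contradiction
      have h1 : (k + 1) % m = (j + 1) % m := hinj _ _ hk1 hj1 (hyk.symm.trans hyj)
      have : k = j := by
        have h2 : ((k + 1) % m + m - 1) % m = ((j + 1) % m + m - 1) % m := by rw [h1]
        rwa [pred_succ k hk, pred_succ j hj] at h2
      subst this
      exact absurd (huj.trans hwk.symm) huw

/-- **The corner block of a polygonal facet** (forward form): as `corner_block`, for a facet `c` of
any size, at a vertex `y` whose hull-edge neighbours on the facet are `u ≠ w`. -/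
theorem corner_block_polygon {X : Finset (EuclideanSpace ℝ (Fin 3))} (hX1 : ∀ z ∈ X, ‖z‖ = 1)
    (h0 : (0 : EuclideanSpace ℝ (Fin 3)) ∈ interior (convexHull ℝ (X : Set (EuclideanSpace ℝ (Fin 3)))))
    {c y u w : EuclideanSpace ℝ (Fin 3)} (hcF : c ∈ facetNormals X)
    (hy : y ∈ tightSet X c) (hu : u ∈ tightSet X c) (hw : w ∈ tightSet X c)
    (hyu : y ≠ u) (hyw : y ≠ w) (huw : u ≠ w)
    (heu : ({y, u} : Finset _) ∈ hullEdges X) (hew : ({y, w} : Finset _) ∈ hullEdges X)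
    (qyu : ⟪y, u⟫ ^ 2 < 1) (qyw : ⟪y, w⟫ ^ 2 < 1) :
    Real.cos (cornerAngle X c y) =
      (⟪u, w⟫ - ⟪y, u⟫ * ⟪y, w⟫) * (Real.sqrt ((1 - ⟪y, u⟫ ^ 2) * (1 - ⟪y, w⟫ ^ 2)))⁻¹ ∧
    Real.sin (cornerAngle X c y) =
      Real.sqrt (1 - ((⟪u, w⟫ - ⟪y, u⟫ * ⟪y, w⟫) *
        (Real.sqrt ((1 - ⟪y, u⟫ ^ 2) * (1 - ⟪y, w⟫ ^ 2)))⁻¹) ^ 2) := by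
  rw [cornerAngle_of_hullEdges hX1 h0 hcF hy hu hw hyu hyw huw heu hew]
  exact corner_forward (hX1 _ (mem_tightSet.1 hy).1) (hX1 _ (mem_tightSet.1 hu).1)
    (hX1 _ (mem_tightSet.1 hw).1) qyu qyw

end Summit.AtomisticToContinuum.Crystallization.Theorems

end
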